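import Mathlib
import HarnessLib
import Summits.AtomisticToContinuum.FouriersLaw.Theses.JunctionLocality
import Summits.AtomisticToContinuum.FouriersLaw.Theorems.JunctionLocalityDefs
import Summits.AtomisticToContinuum.FouriersLaw.Theorems.JunctionLocalityConductanceLowerBoundStubEscapeFloorAux1
import Summits.AtomisticToContinuum.FouriersLaw.Theorems.HonestZwanzigParityStaticsGibbsParity
import Summits.AtomisticToContinuum.FouriersLaw.Theorems.BondHeatUncertaintySubdiffusiveBondHeatGibbsMomentumFourthMoment
import Summits.AtomisticToContinuum.FouriersLaw.Theorems.OddSectorIrreversibilityConeScaleCorrectorStubCorrectorSplitting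

/-!
# Crux `ConductanceLowerBound` (stmt-AtomisticToContinuum-11749), line `kick-dipole-no-collapse`, stub (E) — helper 2:
# regularity of the kick-response kernel and the static contact pairing `⟨p_0² − T, E_L⟩_{μ_T} = T²`

Helper file toward the registered stub `stub_escapeFloor` (E) (lead c1).  Fixed-`N` facts for the pinned anharmonic chain
`P = pinnedChain ω₂ lam β γ` (all parameters `> 0`) at `T > 0`, preparing the ENERGY-BOOKKEEPING (dipole) reading of the
booked dipole `𝔇_N(t) = bookedDipole P N T t = ∫₀ᵗ 𝒥_N` (helper 3):

* `measurable_pairing`, `abs_pairing_le` — for continuous `a` and measurable `b` with `a², b² ∈ L¹(μ_T)` the equilibrium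
  pairing `s ↦ ⟨a, κ_s b⟩_{μ_T}` is measurable in time and bounded by `(‖a‖² + ‖b‖²)/2` (`L²`-contraction of the
  Gibbs-invariant kernels);
* `helper_kdKickKernelBounded` — hence `𝒥_N = kickKernel P N T` is measurable, bounded (`|𝒥_N(s)| ≤ C_N`) and interval
  integrable on every window, so `𝔇_N` is an honest running integral (`bookedDipole_sub`);
* `hamiltonian_update_momentum`, `energyMoment_update_momentum` — `H` and the energy first moment `X = Σ_k k·e_k` under
  the replacement of one momentum;
* `integral_momentum_pow_four_gibbsMeasure` — `∫ p_i⁴ dμ_T = 3T²` (Gaussian recursion of the tree);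
* `helper_kdContactPairingLeftEnergy` — **the static contact pairing** `∫ (p_0² − T)·E_L dμ_T = T²` for the
  left-exit-weighted energy `E_L = H − X/(N−1)` (`N ≥ 2`): `E_L − p_0²/2` does not depend on `p_0`, which is an independent
  `N(0,T)` under `μ_T` (`pinnedChain_integral_indep_sq_momentum_mul_gibbsDensity`), and `∫ (p_0² − T) p_0²/2 dμ_T =
  (3T² − T²)/2 = T²`.  This is the `t = 0` value of the relaxation function `⟨p_0² − T, κ_t E_L⟩_{μ_T}` whose decay IS the
  booked dipole (helper 3), and it matches the normalisation `D_L = (L−1)γ(1 − (γ/T²)∫₀^∞ K_L)` of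
  `BoundaryEscapeDeficit.ResponseIdentity`.
-/

noncomputable section

open MeasureTheory ProbabilityTheory Filter Topology Set
open scoped NNReal ENNReal BigOperators
open Literature.MathematicalPhysics.KineticTheory.HeatConduction
open Literature.Barriers.AtomisticToContinuum.OpenChain
open Summit.AtomisticToContinuum.FouriersLaw.Theorems.JunctionLocality
open Summit.AtomisticToContinuum.FouriersLaw.Theorems

namespace Summit.AtomisticToContinuum.FouriersLaw.Cruxes.ConductanceLowerBound.KickDipoleNoCollapse

variable {N : ℕ}

/-! ### One-momentum updates of `H` and `X` -/

/-- Replacing the momentum `p_i` by `t` changes `H` by `(t² − p_i²)/2`. -/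
theorem hamiltonian_update_momentum (P : OscillatorChain) (N : ℕ) (x : PhaseSpace N) (i : Fin N) (t : ℝ) :
    P.hamiltonian N (x.1, Function.update x.2 i t) = P.hamiltonian N x + (t ^ 2 - x.2 i ^ 2) / 2 := by
  unfold OscillatorChain.hamiltonian
  have h : ∑ j : Fin N, ((Function.update x.2 i t j) ^ 2 / 2 + P.U (x.1 j)) -
      ∑ j : Fin N, (x.2 j ^ 2 / 2 + P.U (x.1 j)) = (t ^ 2 - x.2 i ^ 2) / 2 := by
    rw [← Finset.sum_sub_distrib, Finset.sum_eq_single i]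
    · simp
      ring
    · intro j _ hj
      rw [Function.update_of_ne hj]
      ring
    · intro h; exact absurd (Finset.mem_univ _) h
  simp only
  linarith

/-- Replacing the momentum `p_i` by `t` changes `X = energyMoment` by `i·(t² − p_i²)/2`. -/
theorem energyMoment_update_momentum (P : OscillatorChain) (N : ℕ) (x : PhaseSpace N) (i : Fin N) (t : ℝ) :
    energyMoment P N (x.1, Function.update x.2 i t) = energyMoment P N x + (i.val : ℝ) * (t ^ 2 - x.2 i ^ 2) / 2 := by
  unfold energyMoment
  have h : ∑ k : Fin N, (k.val : ℝ) * ((Function.update x.2 i t k) ^ 2 / 2 + P.U (x.1 k)) -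
      ∑ k : Fin N, (k.val : ℝ) * (x.2 k ^ 2 / 2 + P.U (x.1 k)) = (i.val : ℝ) * (t ^ 2 - x.2 i ^ 2) / 2 := by
    rw [← Finset.sum_sub_distrib, Finset.sum_eq_single i]
    · simp
      ring
    · intro j _ hj
      rw [Function.update_of_ne hj]
      ring
    · intro h; exact absurd (Finset.mem_univ _) h
  simp only
  linarith

/-- **`E_L − p_0²/2` does not depend on `p_0`** (`E_L = H − X/(N−1)`; the weight of site `0` in `X` is `0`). -/
theorem leftEnergy_sub_update (P : OscillatorChain) (hN : 0 < N) (x : PhaseSpace N) (t : ℝ) :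
    (P.hamiltonian N (x.1, Function.update x.2 ⟨0, hN⟩ t) -
        energyMoment P N (x.1, Function.update x.2 ⟨0, hN⟩ t) / ((N : ℝ) - 1) -
        (Function.update x.2 ⟨0, hN⟩ t) ⟨0, hN⟩ ^ 2 / 2) =
      P.hamiltonian N x - energyMoment P N x / ((N : ℝ) - 1) - x.2 ⟨0, hN⟩ ^ 2 / 2 := by
  rw [hamiltonian_update_momentum, energyMoment_update_momentum, Function.update_self]
  simp only [Nat.cast_zero, zero_mul, zero_div, add_zero]
  ring

section Pinned

variable {ω₂ lam β γ : ℝ} (hω : 0 < ω₂) (hl : 0 < lam) (hβ : 0 < β) (hγ : 0 < γ) (hN : 0 < N) {T : ℝ} (hT : 0 < T)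
include hω hl hβ hγ hN hT

/-! ### Equilibrium pairings `s ↦ ⟨a, κ_s b⟩_{μ_T}`: measurability in time and a uniform bound -/

omit hl hN in
/-- **Measurability in time of an equilibrium pairing**: for continuous `a` and measurable `b`,
`s ↦ ∫ a · (κ_s b) dμ_T` is measurable (joint measurability of `(s, z) ↦ κ_s b(z)`). -/
theorem measurable_pairing (hl' : 0 ≤ lam) {a b : PhaseSpace N → ℝ} (ha : Continuous a) (hb : Measurable b) :
    Measurable fun s : ℝ => ∫ z, a z * evolve (pinnedChain ω₂ lam β γ) N T b s z ∂((pinnedChain ω₂ lam β γ).gibbsMeasure N T) := by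
  haveI : IsProbabilityMeasure ((pinnedChain ω₂ lam β γ).gibbsMeasure N T) :=
    pinnedChain_isProbabilityMeasure_gibbsMeasure hω hl' hβ.le γ N hT
  have hF : StronglyMeasurable fun q : ℝ × PhaseSpace N => a q.2 * evolve (pinnedChain ω₂ lam β γ) N T b q.1 q.2 :=
    ((ha.comp continuous_snd).stronglyMeasurable).mul
      (OddSectorIrreversibility.pinnedChain_stronglyMeasurable_act_uncurry hω hl' hβ.le hγ.le T T hb)
  exact (hF.integral_prod_right' (ν := (pinnedChain ω₂ lam β γ).gibbsMeasure N T)).measurable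

/-- **Uniform bound on an equilibrium pairing**: for measurable `a, b` with `a², b² ∈ L¹(μ_T)` and every real `s`,
`a · κ_s b ∈ L¹(μ_T)` and `|∫ a · (κ_s b) dμ_T| ≤ (∫ a² dμ_T + ∫ b² dμ_T)/2` (`2|xy| ≤ x² + y²` and the `L²(μ_T)`-contraction
`∫ (κ_s b)² ≤ ∫ b²` of the Gibbs-invariant kernels). -/
theorem abs_pairing_le {a b : PhaseSpace N → ℝ} (ha : Measurable a) (hb : Measurable b)
    (ha2 : Integrable (fun z => a z ^ 2) ((pinnedChain ω₂ lam β γ).gibbsMeasure N T))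
    (hb2 : Integrable (fun z => b z ^ 2) ((pinnedChain ω₂ lam β γ).gibbsMeasure N T)) (s : ℝ) :
    Integrable (fun z => a z * evolve (pinnedChain ω₂ lam β γ) N T b s z) ((pinnedChain ω₂ lam β γ).gibbsMeasure N T) ∧
    |∫ z, a z * evolve (pinnedChain ω₂ lam β γ) N T b s z ∂((pinnedChain ω₂ lam β γ).gibbsMeasure N T)| ≤
      ((∫ z, a z ^ 2 ∂((pinnedChain ω₂ lam β γ).gibbsMeasure N T)) +
        ∫ z, b z ^ 2 ∂((pinnedChain ω₂ lam β γ).gibbsMeasure N T)) / 2 := by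
  set P := pinnedChain ω₂ lam β γ with hP
  obtain ⟨-, hPb2, hcontr⟩ := SubdiffusiveBondHeat.pinnedChain_sq_act_le_of_sq_integrable hω hl hβ hγ hN hT hb hb2 s.toNNReal
  have hPbm : StronglyMeasurable (evolve P N T b s) := hb.stronglyMeasurable.integral_kernel (κ := P.transitionKernel N T T s.toNNReal)
  have hPb2' : Integrable (fun z => evolve P N T b s z ^ 2) (P.gibbsMeasure N T) := hPb2
  refine ⟨SubdiffusiveBondHeat.integrable_mul_of_sq_aesm ha.aestronglyMeasurable hPbm.aestronglyMeasurable ha2 hPb2', ?_⟩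
  have h := SubdiffusiveBondHeat.abs_integral_mul_le_weighted ha2 hPb2' one_pos
  rw [one_mul, inv_one, one_mul] at h
  have hcontr' : ∫ z, evolve P N T b s z ^ 2 ∂(P.gibbsMeasure N T) ≤ ∫ z, b z ^ 2 ∂(P.gibbsMeasure N T) := hcontr
  linarith

end Pinned

/-! ### Regularity of the kick-response kernel in time -/

/-- **helper — THE KICK-RESPONSE KERNEL IS MEASURABLE, BOUNDED AND LOCALLY INTEGRABLE IN TIME** (fixed `N ≥ 1`): for the
pinned anharmonic chain (all parameters `> 0`) and `T > 0`, `s ↦ kickKernel P N T s` is measurable, there is `C` with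
`|kickKernel P N T s| ≤ C` for every real `s`, and the kernel is interval integrable on every window `[a, b]` — so that the
booked dipole `𝔇_N(t) = ∫₀ᵗ 𝒥_N` is an honest running integral with `𝔇_N(t) − 𝔇_N(τ) = ∫_τ^t 𝒥_N` (`bookedDipole_sub`).
From the halved form `𝒥_N(s) = (γ/T²)⟨p_0² − T, κ_s J⟩_{μ_T}` (helper 1) and the pairing bounds of this file. -/
theorem helper_kdKickKernelBounded : ∀ ω₂ lam β γ : ℝ, 0 < ω₂ → 0 < lam → 0 < β → 0 < γ → ∀ T : ℝ, 0 < T → ∀ N : ℕ, 0 < N → Measurable (kickKernel (pinnedChain ω₂ lam β γ) N T) ∧ (∃ C : ℝ, ∀ s : ℝ, |kickKernel (pinnedChain ω₂ lam β γ) N T s| ≤ C) ∧ ∀ a b : ℝ, IntervalIntegrable (kickKernel (pinnedChain ω₂ lam β γ) N T) volume a b := by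
  intro ω₂ lam β γ hω hl hβ hγ T hT N hN
  set P := pinnedChain ω₂ lam β γ with hP
  have hhalf : kickKernel P N T = fun s => γ / T ^ 2 * ∫ z, (z.2 ⟨0, hN⟩ ^ 2 - T) *
      evolve P N T (totalCurrentObs P N) s z ∂(P.gibbsMeasure N T) :=
    funext fun s => helper_kdKickKernelHalving ω₂ lam β γ hω hl hβ hγ T hT N hN s
  obtain ⟨hkc, hk2, -⟩ := kinExcess_facts hω hl hβ hγ hN hT ⟨0, hN⟩
  obtain ⟨-, -, -, -, hJ2⟩ := evolve_totalCurrentObs_facts hω hl hβ hγ hN hT 0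
  have hJm : Measurable (totalCurrentObs P N) := (OddSectorIrreversibility.continuous_totalBondCurrent ω₂ lam β γ N).measurable
  have hmeas : Measurable (kickKernel P N T) := by
    rw [hhalf]
    exact (measurable_pairing hω hβ hγ hT hl.le hkc hJm).const_mul _
  set C : ℝ := |γ / T ^ 2| * (((∫ z, (z.2 ⟨0, hN⟩ ^ 2 - T) ^ 2 ∂(P.gibbsMeasure N T)) +
      ∫ z, totalCurrentObs P N z ^ 2 ∂(P.gibbsMeasure N T)) / 2) with hC
  have hbound : ∀ s : ℝ, |kickKernel P N T s| ≤ C := by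
    intro s
    rw [hhalf]
    dsimp only
    rw [abs_mul]
    exact mul_le_mul_of_nonneg_left (abs_pairing_le hω hl hβ hγ hN hT hkc.measurable hJm hk2 hJ2 s).2 (abs_nonneg _)
  refine ⟨hmeas, ⟨C, hbound⟩, fun a b => ?_⟩
  refine (intervalIntegrable_const : IntervalIntegrable (fun _ : ℝ => C) volume a b).mono_fun'
    hmeas.aestronglyMeasurable (Eventually.of_forall fun s => ?_)
  show ‖kickKernel P N T s‖ ≤ C
  rw [Real.norm_eq_abs]
  exact hbound s

/-! ### Statics: `∫ p_i⁴ dμ_T = 3T²` and the contact pairing `⟨p_0² − T, E_L⟩_{μ_T} = T²` -/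

/-- **`∫ p_i⁴ dμ_T = 3T²`**: the momentum `p_i` is exactly `N(0,T)` under the Gibbs state (Gaussian recursion
`∫ p^{k+2} e^{-H/T} = T(k+1) ∫ p^k e^{-H/T}` of the tree, `k = 2` and `k = 0`). -/
theorem integral_momentum_pow_four_gibbsMeasure {ω₂ lam β : ℝ} (hω : 0 < ω₂) (hl' : 0 ≤ lam) (hβ' : 0 ≤ β) (γ : ℝ) {T : ℝ}
    (hT : 0 < T) (i : Fin N) :
    ∫ z, z.2 i ^ 4 ∂((pinnedChain ω₂ lam β γ).gibbsMeasure N T) = 3 * T ^ 2 := by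
  set P := pinnedChain ω₂ lam β γ with hP
  rw [P.integral_gibbsMeasure]
  have h4 := SubdiffusiveBondHeat.pinnedChain_integral_momentum_pow_add_two hω hl' hβ' γ N hT i (k := 2) le_rfl
  have h2 := SubdiffusiveBondHeat.pinnedChain_integral_momentum_pow_add_two hω hl' hβ' γ N hT i (k := 0) (Nat.zero_le _)
  have hZ : 0 < ∫ x, P.gibbsDensity N T x := integral_exp_pos (pinnedChain_integrable_gibbsDensity hω hl' hβ' γ N hT)
  have h0 : ∫ x, x.2 i ^ 0 * P.gibbsDensity N T x = ∫ x, P.gibbsDensity N T x := by simp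
  simp only [Nat.reduceAdd, Nat.cast_ofNat, Nat.cast_zero, zero_add, mul_one] at h4 h2
  rw [h0] at h2
  rw [h4, h2]
  field_simp
  ring

/-- **helper — THE STATIC CONTACT PAIRING `⟨p_0² − T, E_L⟩_{μ_T} = T²`** (`N ≥ 2`, `E_L = H − X/(N−1)` the
left-exit-weighted energy of `ConeScaleCorrector`/`BoundaryEscapeDeficit`): `E_L − p_0²/2` does not depend on `p_0`
(`leftEnergy_sub_update`), `p_0 ~ N(0,T)` is independent of the other coordinates under `μ_T`
(`pinnedChain_integral_indep_sq_momentum_mul_gibbsDensity`: `∫ (p_0² − T) F dμ_T = 0`), and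
`∫ (p_0² − T)·p_0²/2 dμ_T = (3T² − T·T)/2 = T²`. -/
theorem helper_kdContactPairingLeftEnergy : ∀ ω₂ lam β γ : ℝ, 0 < ω₂ → 0 < lam → 0 < β → 0 < γ → ∀ T : ℝ, 0 < T → ∀ (N : ℕ) (hN : 2 ≤ N), ∫ z, (z.2 ⟨0, by omega⟩ ^ 2 - T) * ((pinnedChain ω₂ lam β γ).hamiltonian N z - energyMoment (pinnedChain ω₂ lam β γ) N z / ((N : ℝ) - 1)) ∂((pinnedChain ω₂ lam β γ).gibbsMeasure N T) = T ^ 2 := by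
  intro ω₂ lam β γ hω hl hβ hγ T hT N hN
  have hN0 : 0 < N := by omega
  set P := pinnedChain ω₂ lam β γ with hP
  set i0 : Fin N := ⟨0, hN0⟩ with hi0
  haveI : IsProbabilityMeasure (P.gibbsMeasure N T) := pinnedChain_isProbabilityMeasure_gibbsMeasure hω hl.le hβ.le γ N hT
  -- the `p_0`-independent part `F = E_L − p_0²/2`
  set F : PhaseSpace N → ℝ := fun z => P.hamiltonian N z - energyMoment P N z / ((N : ℝ) - 1) - z.2 i0 ^ 2 / 2 with hF
  have hHc : Continuous (P.hamiltonian N) := pinnedChain_continuous_hamiltonian ω₂ lam β γ N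
  have hXc : Continuous (energyMoment P N) :=
    (OddSectorIrreversibility.contDiff_energyMoment_of_contDiff P (N := N) (pinnedChain_contDiff_U ω₂ lam β γ (n := 0))
      (pinnedChain_contDiff_V ω₂ lam β γ (n := 0))).continuous
  have hEc : Continuous fun z => P.hamiltonian N z - energyMoment P N z / ((N : ℝ) - 1) := hHc.sub (hXc.div_const _)
  have hFc : Continuous F := hEc.sub (by fun_prop)
  have hH0 : ∀ z, 0 ≤ P.hamiltonian N z := fun z => pinnedChain_hamiltonian_nonneg hω.le hl.le hβ.le γ N z
  have hFle : ∀ z, |F z| ≤ 1 * (1 + P.hamiltonian N z) := by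
    intro z
    obtain ⟨hE0, hEH⟩ := OddSectorIrreversibility.pinnedChain_leftEnergy_nonneg_le hω.le hl.le hβ.le γ hN z
    have hp := SubdiffusiveBondHeat.pinnedChain_sq_momentum_le hω.le hl.le hβ.le γ N z i0
    have hp0 : 0 ≤ z.2 i0 ^ 2 := sq_nonneg _
    rw [abs_le]
    constructor <;> [skip; skip] <;> simp only [hF] <;> nlinarith [hH0 z]
  have hind : ∀ (z : PhaseSpace N) (t : ℝ), F (z.1, Function.update z.2 i0 t) = F z :=
    fun z t => leftEnergy_sub_update P hN0 z t
  obtain ⟨hiF, hiFp, hFid⟩ := HonestZwanzig.pinnedChain_integral_indep_sq_momentum_mul_gibbsDensity hω hl.le hβ.le γ N hT i0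
    hFc zero_le_one hFle hind
  -- `∫ (p_0² − T) F dμ_T = 0`
  have hF0 : ∫ z, (z.2 i0 ^ 2 - T) * F z ∂(P.gibbsMeasure N T) = 0 := by
    rw [P.integral_gibbsMeasure]
    have he : ∀ z, (z.2 i0 ^ 2 - T) * F z * P.gibbsDensity N T z =
        F z * z.2 i0 ^ 2 * P.gibbsDensity N T z - T * (F z * P.gibbsDensity N T z) := fun z => by ring
    rw [integral_congr_ae (Eventually.of_forall he), integral_sub hiFp (hiF.const_mul T), integral_const_mul, hFid]
    ring
  -- `∫ (p_0² − T) p_0²/2 dμ_T = T²`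
  have hp4 : Integrable (fun z : PhaseSpace N => z.2 i0 ^ 4) (P.gibbsMeasure N T) :=
    P.integrable_gibbsMeasure (SubdiffusiveBondHeat.pinnedChain_integrable_momentum_pow_mul_gibbsDensity hω hl.le hβ.le γ N hT i0 le_rfl)
  have hp2 : Integrable (fun z : PhaseSpace N => z.2 i0 ^ 2) (P.gibbsMeasure N T) :=
    P.integrable_gibbsMeasure (SubdiffusiveBondHeat.pinnedChain_integrable_momentum_pow_mul_gibbsDensity hω hl.le hβ.le γ N hT i0 (by norm_num))
  have hkin : ∫ z, (z.2 i0 ^ 2 - T) * (z.2 i0 ^ 2 / 2) ∂(P.gibbsMeasure N T) = T ^ 2 := by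
    have he : ∀ z : PhaseSpace N, (z.2 i0 ^ 2 - T) * (z.2 i0 ^ 2 / 2) = (1 / 2) * z.2 i0 ^ 4 - (T / 2) * z.2 i0 ^ 2 := fun z => by ring
    rw [integral_congr_ae (Eventually.of_forall he), integral_sub (hp4.const_mul _) (hp2.const_mul _), integral_const_mul,
      integral_const_mul, integral_momentum_pow_four_gibbsMeasure hω hl.le hβ.le γ hT i0,
      SubdiffusiveBondHeat.pinnedChain_integral_sq_momentum_gibbsMeasure hω hl.le hβ.le γ N hT i0]
    ring
  -- assemble: `E_L = p_0²/2 + F`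
  have hsplit : ∀ z, (z.2 i0 ^ 2 - T) * (P.hamiltonian N z - energyMoment P N z / ((N : ℝ) - 1)) =
      (z.2 i0 ^ 2 - T) * (z.2 i0 ^ 2 / 2) + (z.2 i0 ^ 2 - T) * F z := fun z => by simp only [hF]; ring
  have hi1 : Integrable (fun z : PhaseSpace N => (z.2 i0 ^ 2 - T) * (z.2 i0 ^ 2 / 2)) (P.gibbsMeasure N T) := by
    have := (hp4.const_mul (1 / 2)).sub (hp2.const_mul (T / 2))
    exact this.congr (Eventually.of_forall fun z => by simp only [Pi.sub_apply]; ring)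
  have hi2 : Integrable (fun z : PhaseSpace N => (z.2 i0 ^ 2 - T) * F z) (P.gibbsMeasure N T) := by
    have h1 : Integrable (fun z => F z * z.2 i0 ^ 2) (P.gibbsMeasure N T) := P.integrable_gibbsMeasure hiFp
    have h2 : Integrable F (P.gibbsMeasure N T) := P.integrable_gibbsMeasure hiF
    exact (h1.sub (h2.const_mul T)).congr (Eventually.of_forall fun z => by simp only [Pi.sub_apply]; ring)
  show ∫ z, (z.2 i0 ^ 2 - T) * (P.hamiltonian N z - energyMoment P N z / ((N : ℝ) - 1)) ∂(P.gibbsMeasure N T) = T ^ 2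
  rw [integral_congr_ae (Eventually.of_forall hsplit), integral_add hi1 hi2, hkin, hF0, add_zero]


end Summit.AtomisticToContinuum.FouriersLaw.Cruxes.ConductanceLowerBound.KickDipoleNoCollapse

end
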